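/-
Copyright (c) 2026 the pub-hodgecm-mathlib formalisation cell (harness21).  Prover seat hodgecm-mathlib-R90-C14-p02 (g0), R90-TF section S2 «Ch11-arch» (S2 dealer
K2E1b-plan (g7) DEAL «S2-R-c» 2026-09-04T22:38:20Z (1); R90-C11-audit1 (g0) census R-a…R-d 22:35:43Z, point R-c «class-function invariance is the hinge»): the three F-C3
matrix predicates of ★ p862403 `R90S2EllipticMatDefs` are CONJUGATION-INVARIANT — functions of the characteristic polynomial.
-/
import Summits.HodgeConjecture.HodgeConjecture.Theorems.R90S2EllipticMatDefs   -- ★ p862403 (K2E3-p23): `IsEllipticMat`, `IsRegSemisimpleMat`, `IsRegNonEllipticMat`; brings ★ `UnitaryGroup.archLocal`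
import Mathlib.LinearAlgebra.Matrix.Charpoly.Basic
import HarnessLib

/-!
# R90-TF ∕ S2 «Ch11-arch» — `R90S2EllipticMatConj`: ELLIPTIC ∕ REGULAR SEMISIMPLE ∕ REGULAR NON-ELLIPTIC ARE CLASS FUNCTIONS (invariant under conjugation in `GL_N(ℂ)`,
# hence on every `U(σ_w J)(ℂ)`)

Cell `hodgecm-mathlib`, programme R90-TF, section S2 (dealer K2E1b-plan (g7), DEAL «S2-R-c» 22:38:20Z), crux H413 = `stmt-HodgeConjecture-24833` (supports-only helper lane
`--kind proof --supports stmt-HodgeConjecture-24833 --as helper`; closes nothing).  WHY (audit R-c): architecture (B)'s corollary and the successor's `IsCuspidalAt` read «`out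
(ConjClasses.map prτ c)` is regular non-elliptic» from a REPRESENTATIVE of a conjugacy class — so the predicates must not depend on the representative.  They do not: all three
are functions of `g.charpoly` (★ p862403 §1: roots on the unit circle ∕ separable ∕ the conjunction), and the characteristic polynomial is a class function (Mathlib
`Matrix.charpoly_units_conj`: `(u·N·u⁻¹).charpoly = N.charpoly`).  THEOREMS ONLY (no `def`, no `instance`, no `notation`, no named-fact hypothesis, no `sorry`; default heartbeats).
* §1 matrix-units level `(u : (Matrix (Fin N) (Fin N) ℂ)ˣ)`: **`charpoly_conj_units`**, **`isEllipticMat_units_conj`**, **`isRegSemisimpleMat_units_conj`**, **`isRegNonEllipticMat_units_conj`**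
  (orientation `u * g * u⁻¹`) and the primed twins for `u⁻¹ * g * u`.
* §2 `GL (Fin N) ℂ` level `(u g : GL (Fin N) ℂ)` (coercions only; `GL = units`): **`isEllipticMat_conj_gl`**, **`isRegSemisimpleMat_conj_gl`**, **`isRegNonEllipticMat_conj_gl`**.
* §3 the archimedean unitary group `(g u : ↥(UnitaryGroup.archLocal E N J w))` (coercions only): **`isEllipticMat_conj_archLocal`**, **`isRegSemisimpleMat_conj_archLocal`**,
  **`isRegNonEllipticMat_conj_archLocal`** — the form the `ConjClasses`-level readers consume.
HONEST LABEL: HC_CM is proved only modulo the 7 printed citations (2 remaining named inputs: hLiu418 = `stmt-HodgeConjecture-24832`, h413 = `stmt-HodgeConjecture-24833`) until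
rung 0 closes; conjugation lemmas pay no socket — they are the class-function hinge of the two-place binders; count-neutral.

References: [Rogawski1990] §3.1 p. 19 (regular, elliptic elements; conjugacy classes), §4.9; [Knapp1986] Ch. I §1.
-/

set_option autoImplicit false
-- the mandated namespace repeats the single-problem summit's segment (`HodgeConjecture.HodgeConjecture`)
set_option linter.dupNamespace false

noncomputable section

open NumberField NumberField.InfinitePlace Polynomial
open scoped Matrix MatrixGroups

namespace Summit.HodgeConjecture.HodgeConjecture.R90.S2

open Literature.NumberTheory.Automorphic

/-! ## §1 Matrix-units level: the characteristic polynomial and the three predicates are class functions [§3.1 p. 19] -/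

/-- **The characteristic polynomial is a class function** (units form, orientation `u·g·u⁻¹`): Mathlib `Matrix.charpoly_units_conj` with the units inverse read as the
matrix inverse (`Matrix.coe_units_inv`). [cite: Knapp1986, Ch. I §1] -/
theorem charpoly_conj_units {N : ℕ} (u : (Matrix (Fin N) (Fin N) ℂ)ˣ) (g : Matrix (Fin N) (Fin N) ℂ) :
    ((u : Matrix (Fin N) (Fin N) ℂ) * g * ((u⁻¹ : (Matrix (Fin N) (Fin N) ℂ)ˣ) : Matrix (Fin N) (Fin N) ℂ)).charpoly = g.charpoly := by
  rw [Matrix.coe_units_inv]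
  exact Matrix.charpoly_units_conj u g

/-- The primed orientation `u⁻¹·g·u` (Mathlib `Matrix.charpoly_units_conj'`). [cite: Knapp1986, Ch. I §1] -/
theorem charpoly_conj_units' {N : ℕ} (u : (Matrix (Fin N) (Fin N) ℂ)ˣ) (g : Matrix (Fin N) (Fin N) ℂ) :
    (((u⁻¹ : (Matrix (Fin N) (Fin N) ℂ)ˣ) : Matrix (Fin N) (Fin N) ℂ) * g * (u : Matrix (Fin N) (Fin N) ℂ)).charpoly = g.charpoly := by
  rw [Matrix.coe_units_inv]
  exact Matrix.charpoly_units_conj' u g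

/-- **`IsEllipticMat` is conjugation-invariant** (eigenvalues on the unit circle is a property of the characteristic polynomial). [cite: Rogawski1990, §3.1 p. 19] [cite: Knapp1986, Ch. I §1] -/
theorem isEllipticMat_units_conj {N : ℕ} (u : (Matrix (Fin N) (Fin N) ℂ)ˣ) (g : Matrix (Fin N) (Fin N) ℂ) :
    IsEllipticMat ((u : Matrix (Fin N) (Fin N) ℂ) * g * ((u⁻¹ : (Matrix (Fin N) (Fin N) ℂ)ˣ) : Matrix (Fin N) (Fin N) ℂ)) ↔ IsEllipticMat g := by
  rw [isEllipticMat_iff, isEllipticMat_iff, charpoly_conj_units]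

/-- `IsEllipticMat` is conjugation-invariant, orientation `u⁻¹·g·u`. [cite: Rogawski1990, §3.1 p. 19] -/
theorem isEllipticMat_units_conj' {N : ℕ} (u : (Matrix (Fin N) (Fin N) ℂ)ˣ) (g : Matrix (Fin N) (Fin N) ℂ) :
    IsEllipticMat (((u⁻¹ : (Matrix (Fin N) (Fin N) ℂ)ˣ) : Matrix (Fin N) (Fin N) ℂ) * g * (u : Matrix (Fin N) (Fin N) ℂ)) ↔ IsEllipticMat g := by
  rw [isEllipticMat_iff, isEllipticMat_iff, charpoly_conj_units']

/-- **`IsRegSemisimpleMat` is conjugation-invariant** (separability of the characteristic polynomial). [cite: Rogawski1990, §3.1 p. 19] -/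
theorem isRegSemisimpleMat_units_conj {N : ℕ} (u : (Matrix (Fin N) (Fin N) ℂ)ˣ) (g : Matrix (Fin N) (Fin N) ℂ) :
    IsRegSemisimpleMat ((u : Matrix (Fin N) (Fin N) ℂ) * g * ((u⁻¹ : (Matrix (Fin N) (Fin N) ℂ)ˣ) : Matrix (Fin N) (Fin N) ℂ)) ↔ IsRegSemisimpleMat g := by
  rw [isRegSemisimpleMat_iff, isRegSemisimpleMat_iff, charpoly_conj_units]

/-- `IsRegSemisimpleMat` is conjugation-invariant, orientation `u⁻¹·g·u`. [cite: Rogawski1990, §3.1 p. 19] -/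
theorem isRegSemisimpleMat_units_conj' {N : ℕ} (u : (Matrix (Fin N) (Fin N) ℂ)ˣ) (g : Matrix (Fin N) (Fin N) ℂ) :
    IsRegSemisimpleMat (((u⁻¹ : (Matrix (Fin N) (Fin N) ℂ)ˣ) : Matrix (Fin N) (Fin N) ℂ) * g * (u : Matrix (Fin N) (Fin N) ℂ)) ↔ IsRegSemisimpleMat g := by
  rw [isRegSemisimpleMat_iff, isRegSemisimpleMat_iff, charpoly_conj_units']

/-- **`IsRegNonEllipticMat` is conjugation-invariant** (audit R-c's hinge: the F-C3 test class «regular semisimple and not elliptic» is a union of conjugacy classes).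
[cite: Rogawski1990, §3.1 p. 19; §4.9] -/
theorem isRegNonEllipticMat_units_conj {N : ℕ} (u : (Matrix (Fin N) (Fin N) ℂ)ˣ) (g : Matrix (Fin N) (Fin N) ℂ) :
    IsRegNonEllipticMat ((u : Matrix (Fin N) (Fin N) ℂ) * g * ((u⁻¹ : (Matrix (Fin N) (Fin N) ℂ)ˣ) : Matrix (Fin N) (Fin N) ℂ)) ↔ IsRegNonEllipticMat g := by
  rw [isRegNonEllipticMat_iff, isRegNonEllipticMat_iff, isRegSemisimpleMat_units_conj, isEllipticMat_units_conj]

/-- `IsRegNonEllipticMat` is conjugation-invariant, orientation `u⁻¹·g·u`. [cite: Rogawski1990, §3.1 p. 19; §4.9] -/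
theorem isRegNonEllipticMat_units_conj' {N : ℕ} (u : (Matrix (Fin N) (Fin N) ℂ)ˣ) (g : Matrix (Fin N) (Fin N) ℂ) :
    IsRegNonEllipticMat (((u⁻¹ : (Matrix (Fin N) (Fin N) ℂ)ˣ) : Matrix (Fin N) (Fin N) ℂ) * g * (u : Matrix (Fin N) (Fin N) ℂ)) ↔ IsRegNonEllipticMat g := by
  rw [isRegNonEllipticMat_iff, isRegNonEllipticMat_iff, isRegSemisimpleMat_units_conj', isEllipticMat_units_conj']

/-! ## §2 `GL_N(ℂ)` level (`GL (Fin N) ℂ` = the units of `Matrix (Fin N) (Fin N) ℂ`; coercions only) -/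

/-- `IsEllipticMat` of the matrix of `u g u⁻¹ ∈ GL_N(ℂ)` iff of the matrix of `g`. [cite: Rogawski1990, §3.1 p. 19] -/
theorem isEllipticMat_conj_gl {N : ℕ} (u g : GL (Fin N) ℂ) :
    IsEllipticMat ((u * g * u⁻¹ : GL (Fin N) ℂ) : Matrix (Fin N) (Fin N) ℂ) ↔ IsEllipticMat (g : Matrix (Fin N) (Fin N) ℂ) := by
  rw [Units.val_mul, Units.val_mul]
  exact isEllipticMat_units_conj u g

/-- `IsRegSemisimpleMat` of the matrix of `u g u⁻¹ ∈ GL_N(ℂ)` iff of the matrix of `g`. [cite: Rogawski1990, §3.1 p. 19] -/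
theorem isRegSemisimpleMat_conj_gl {N : ℕ} (u g : GL (Fin N) ℂ) :
    IsRegSemisimpleMat ((u * g * u⁻¹ : GL (Fin N) ℂ) : Matrix (Fin N) (Fin N) ℂ) ↔ IsRegSemisimpleMat (g : Matrix (Fin N) (Fin N) ℂ) := by
  rw [Units.val_mul, Units.val_mul]
  exact isRegSemisimpleMat_units_conj u g

/-- **`IsRegNonEllipticMat` of the matrix of `u g u⁻¹ ∈ GL_N(ℂ)` iff of the matrix of `g`** — the `GL`-coerced form of audit R-c. [cite: Rogawski1990, §3.1 p. 19; §4.9] -/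
theorem isRegNonEllipticMat_conj_gl {N : ℕ} (u g : GL (Fin N) ℂ) :
    IsRegNonEllipticMat ((u * g * u⁻¹ : GL (Fin N) ℂ) : Matrix (Fin N) (Fin N) ℂ) ↔ IsRegNonEllipticMat (g : Matrix (Fin N) (Fin N) ℂ) := by
  rw [Units.val_mul, Units.val_mul]
  exact isRegNonEllipticMat_units_conj u g

/-! ## §3 On the archimedean unitary group `U(σ_w J)(ℂ)` = ★ `UnitaryGroup.archLocal E N J w` (a subgroup of `GL_N(ℂ)`; coercions only) -/

section ArchLocal

variable (E : Type) [Field E] (N : ℕ) (J : Matrix (Fin N) (Fin N) E) (w : {w : InfinitePlace E // IsComplex w})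

/-- `IsEllipticMat` is constant on `U(σ_w J)(ℂ)`-conjugacy classes. [cite: Rogawski1990, §3.1 p. 19] [cite: Knapp1986, Ch. I §1] -/
theorem isEllipticMat_conj_archLocal (u g : UnitaryGroup.archLocal E N J w) :
    IsEllipticMat (((u * g * u⁻¹ : UnitaryGroup.archLocal E N J w) : GL (Fin N) ℂ) : Matrix (Fin N) (Fin N) ℂ) ↔
      IsEllipticMat (((g : UnitaryGroup.archLocal E N J w) : GL (Fin N) ℂ) : Matrix (Fin N) (Fin N) ℂ) := by
  rw [Subgroup.coe_mul, Subgroup.coe_mul, Subgroup.coe_inv]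
  exact isEllipticMat_conj_gl _ _

/-- `IsRegSemisimpleMat` is constant on `U(σ_w J)(ℂ)`-conjugacy classes. [cite: Rogawski1990, §3.1 p. 19] -/
theorem isRegSemisimpleMat_conj_archLocal (u g : UnitaryGroup.archLocal E N J w) :
    IsRegSemisimpleMat (((u * g * u⁻¹ : UnitaryGroup.archLocal E N J w) : GL (Fin N) ℂ) : Matrix (Fin N) (Fin N) ℂ) ↔
      IsRegSemisimpleMat (((g : UnitaryGroup.archLocal E N J w) : GL (Fin N) ℂ) : Matrix (Fin N) (Fin N) ℂ) := by
  rw [Subgroup.coe_mul, Subgroup.coe_mul, Subgroup.coe_inv]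
  exact isRegSemisimpleMat_conj_gl _ _

/-- **`IsRegNonEllipticMat` is constant on `U(σ_w J)(ℂ)`-conjugacy classes** — so «the class `c` is regular non-elliptic», read from any representative (e.g. `c.out` of a
`ConjClasses`), is well defined: the hinge of architecture (B)'s corollary and of the successor's `IsCuspidalAt` (audit R-c). [cite: Rogawski1990, §3.1 p. 19; §4.9] -/
theorem isRegNonEllipticMat_conj_archLocal (u g : UnitaryGroup.archLocal E N J w) :
    IsRegNonEllipticMat (((u * g * u⁻¹ : UnitaryGroup.archLocal E N J w) : GL (Fin N) ℂ) : Matrix (Fin N) (Fin N) ℂ) ↔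
      IsRegNonEllipticMat (((g : UnitaryGroup.archLocal E N J w) : GL (Fin N) ℂ) : Matrix (Fin N) (Fin N) ℂ) := by
  rw [Subgroup.coe_mul, Subgroup.coe_mul, Subgroup.coe_inv]
  exact isRegNonEllipticMat_conj_gl _ _

/-- **`IsConj`-invariance on `U(σ_w J)(ℂ)`**: conjugate elements of the archimedean unitary group are simultaneously regular non-elliptic — the statement the
`ConjClasses`-level readers use (`ConjClasses.mk g = ConjClasses.mk g' ↔ IsConj g g'`). [cite: Rogawski1990, §3.1 p. 19; §4.9] -/
theorem isRegNonEllipticMat_of_isConj_archLocal {g g' : UnitaryGroup.archLocal E N J w} (h : IsConj g g') :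
    IsRegNonEllipticMat (((g : UnitaryGroup.archLocal E N J w) : GL (Fin N) ℂ) : Matrix (Fin N) (Fin N) ℂ) ↔
      IsRegNonEllipticMat (((g' : UnitaryGroup.archLocal E N J w) : GL (Fin N) ℂ) : Matrix (Fin N) (Fin N) ℂ) := by
  obtain ⟨c, hc⟩ := h
  -- `c * g * c⁻¹ = g'`
  have hg' : (c : UnitaryGroup.archLocal E N J w) * g * (c : UnitaryGroup.archLocal E N J w)⁻¹ = g' := by
    rw [hc.eq, mul_inv_cancel_right]
  rw [← hg']
  exact (isRegNonEllipticMat_conj_archLocal E N J w _ g).symm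

end ArchLocal

end Summit.HodgeConjecture.HodgeConjecture.R90.S2

end
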